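import Summits.MatrixMultiplication.OmegaCensus.SmallFormats.MatMul22nRankGF7ThreeNPlusFourReduction
import Summits.MatrixMultiplication.OmegaCensus.SmallFormats.MatMul22nRankGF7Slack3Counting
import HarnessLib

/-!
# ω-census family (a): tightness of an LP-extremal point of the slack-`s` `𝔽₇` X-cap system, for every `s`

Cell `pub-omega` (unit `pub-omega-tensor-g14`), topic `Summits/MatrixMultiplication/OmegaCensus` (sub-folder `SmallFormats`).
Framing (verbatim): lottery ticket; floor = certified bounds/negative ranges. HONEST FRAMING: kernel infrastructure (the slack-generic
version of the tightness block inside `noTightPoint7_3_156`, p332049), no bound by itself: a point of the 1274 cap / row-plane rows of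
`xcapSys7s s` with total `≥ 52·s` (the LP value, `noTightPoint7_lp`) has `z = x 400 = 0`, every tangent row-list sum equal to `s`, every
row-plane row-list sum equal to `2s`, every passant row-list sum `≤ s`, and total exactly `52·s`. This is step (K1) of the kernel route for the
engine-decided cells `NoTightPoint7 4 208` / `NoTightPoint7 5 260` (`pub-omega-tensor-g14/METHOD-CONGRUENCE-g14.md §6`). Nothing here is progress on `ω`.
-/

namespace Summit.MatrixMultiplication.OmegaCensus.SmallFormats

open Finset

/-- **Tightness at the LP value (slack-generic).** If a point of the cap / row-plane rows of `xcapSys7s s` has total `≥ 52·s`, then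
`x 400 = 0`, all 384 tangent row-list sums equal `s`, all 8 row-plane row-list sums equal `2·s`, all passant row-list sums are `≤ s`,
and the total over the 400 matrix classes is exactly `52·s`. -/
theorem tight7_of_total_ge (s : ℕ) (x : ℕ → ℕ) (hrows : ∀ r < 1274, capRowVal7 x r ≤ rhs7s s r)
    (hge : (52 * s : ℤ) ≤ ∑ j ∈ range 401, (x j : ℤ)) :
    x 400 = 0 ∧ (∀ r < 384, xrs7 x r = s) ∧ (∀ k < 8, xrs7 x (1266 + k) = 2 * (s : ℤ)) ∧
      (∀ r, 384 ≤ r → r < 1266 → xrs7 x r ≤ s) ∧ ∑ j ∈ range 400, (x j : ℤ) = 52 * s := by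
  have hrow : ∀ r < 1274, xrs7 x r + (x 400 : ℤ) ≤ rhs7s s r := by
    intro r hr
    have h := hrows r hr
    unfold capRowVal7 at h
    rwa [capRow_eq_xrs7 x hr] at h
  have hrhsT : ∀ r < 1266, rhs7s s r = s := fun r hr => by simp [rhs7s, hr]
  have hrhsR : ∀ r, 1266 ≤ r → r < 1274 → rhs7s s r = 2 * (s : ℤ) := fun r h1 h2 => by
    simp [rhs7s, show ¬ r < 1266 by omega, h2]
  have hTot : ∑ j ∈ range 401, (x j : ℤ) = ∑ j ∈ range 400, (x j : ℤ) + (x 400 : ℤ) := sum_range_succ _ _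
  have hcount := tight_count7 x
  have hS1 : ∑ r ∈ range 384, xrs7 x r ≤ ∑ r ∈ range 384, ((s : ℤ) - (x 400 : ℤ)) :=
    sum_le_sum fun r hr => by
      have hr' := mem_range.1 hr
      have := hrow r (by omega); rw [hrhsT r (by omega)] at this; linarith
  have hS2 : ∑ k ∈ range 8, xrs7 x (1266 + k) ≤ ∑ k ∈ range 8, (2 * (s : ℤ) - (x 400 : ℤ)) :=
    sum_le_sum fun k hk => by
      have hk' := mem_range.1 hk
      have := hrow (1266 + k) (by omega); rw [hrhsR (1266 + k) (by omega) (by omega)] at this; linarith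
  have h1 : ∑ r ∈ range 384, ((s : ℤ) - (x 400 : ℤ)) = 384 * ((s : ℤ) - (x 400 : ℤ)) := by
    rw [sum_const, card_range, nsmul_eq_mul]; push_cast; ring
  have h2 : ∑ k ∈ range 8, (2 * (s : ℤ) - (x 400 : ℤ)) = 8 * (2 * (s : ℤ) - (x 400 : ℤ)) := by
    rw [sum_const, card_range, nsmul_eq_mul]; push_cast; ring
  have hz : x 400 = 0 := by
    have h0 : (0 : ℤ) ≤ (x 400 : ℤ) := Int.natCast_nonneg _
    have hzle : (x 400 : ℤ) ≤ 0 := by linarith [hS1, hS2, hcount, hTot, hge, h1, h2]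
    have : x 400 ≤ 0 := by exact_mod_cast hzle
    omega
  simp only [hz, Nat.cast_zero, sub_zero, add_zero] at hS1 hS2 hrow hTot h1 h2
  have hS1eq : ∑ r ∈ range 384, xrs7 x r = ∑ r ∈ range 384, (s : ℤ) := by
    apply le_antisymm hS1
    linarith [hS2, hcount, hTot, hge, h1, h2]
  have hS2eq : ∑ k ∈ range 8, xrs7 x (1266 + k) = ∑ k ∈ range 8, (2 * (s : ℤ)) := by
    apply le_antisymm hS2
    linarith [hS1, hcount, hTot, hge, h1, h2]
  have hT : ∀ r < 384, xrs7 x r = s := by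
    have := (sum_eq_sum_iff_of_le (fun r hr => by
      have hr' := mem_range.1 hr
      have := hrow r (by omega); rw [hrhsT r (by omega)] at this; exact this)).1 hS1eq
    exact fun r hr => this r (mem_range.2 hr)
  have hR : ∀ k < 8, xrs7 x (1266 + k) = 2 * (s : ℤ) := by
    have := (sum_eq_sum_iff_of_le (fun k hk => by
      have hk' := mem_range.1 hk
      have := hrow (1266 + k) (by omega); rw [hrhsR (1266 + k) (by omega) (by omega)] at this; exact this)).1 hS2eq
    exact fun k hk => this k (mem_range.2 hk)
  have hP : ∀ r, 384 ≤ r → r < 1266 → xrs7 x r ≤ s := fun r h1 h2 => by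
    have := hrow r (by omega); rw [hrhsT r h2] at this; exact this
  have hTot52 : ∑ j ∈ range 400, (x j : ℤ) = 52 * s := by
    linarith [hcount, hS1eq, hS2eq, hTot, hge, h1, h2]
  exact ⟨hz, hT, hR, hP, hTot52⟩

/-- Row sums of the rank-one matrix `μ(w,i) = x (p7 w i)` at a tight point: every row sums to `2·s`. -/
theorem mu_row_sum_of_tight (s : ℕ) (x : ℕ → ℕ) (hR : ∀ k < 8, xrs7 x (1266 + k) = 2 * (s : ℤ)) :
    ∀ w < 8, ((∑ i ∈ range 8, x (p7 w i) : ℕ) : ℤ) = 2 * (s : ℤ) := by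
  intro w hw
  have h := ruling_sum7 x hw
  rw [hR w hw] at h
  push_cast
  exact h.symm

end Summit.MatrixMultiplication.OmegaCensus.SmallFormats
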